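import Summits.QuantumFields.YangMills.Theorems.BalabanUVNodesN08AlphaZeroData

/-!
# Route «BalabanUVNodes», Track-A DAG node N08 = [Balaban1985UV3] — THE (α) CLAUSE OF THE d = 3 LANE: A LOCATED TYPING LOOSENESS OF ITS
# AUXILIARY DATA — `UVStability3DInputs.AlphaData` carries the (63)-binder G3D-07 at EVERY `k : ℕ`, so its far-term bound G3D-06 must have a
# nonnegative right side at every step, ALSO BEYOND THE RUN; for constants records with `Cfar·C63 > 0` whose seventh-order currency
# `g_k⁷(r(g_k)p(g_k))⁷` turns NEGATIVE at some step (e.g. print's exponent `r₀ = 2` at any step with `g_k > e` — and `g_k = g√(L^kε)` exceeds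
# every bound for large `k`) the type `AlphaData 𝔊 𝔠 X 𝔖` is EMPTY: the (α) input bundle has no instance there

Cell `pub-ymgap`, seat `pub-ymgap-dag-n08-d` gen 6 (director-ym R134 row at the (α) granularity; dag-lead REBALANCE-69 «stay on N08 s1»).  `bears_on:
R4∕N08`; filed `--supports stmt-QuantumFields-20290 --as helper` (K1⁗).  THEOREMS ONLY (def-free), sorry-free, standard axioms; found while building
the zero auxiliary data of `…N08AlphaZeroData` (its hypothesis `hfar`).

WHAT THIS FILE PROVES.
* §1 `singletonDom` — the one-block localisation domain (the quantifier domain of G3D-06 is inhabited); ★ `isEmpty_alphaData_of_farCurrency_neg`: if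
  `0 < 𝔠.Cfar`, `0 < 𝔠.C63` and at SOME step `k` the currency `g_k⁷·(r(g_k)·p(g_k))⁷ < 0`, then `IsEmpty (AlphaData 𝔊 𝔠 X 𝔖)` for EVERY external
  input `X` and series `𝔖` — G3D-06 (`Binders.FarTermsDecayAsCited`) at the field `(𝔄.Λc k).far_le` would bound an absolute value by a negative number.
* §2 the sign of the currency off the run: with `x := 1 + log g_k⁻¹ < 0` (i.e. `g_k > e`) Mathlib's real power of a negative base reads
  `x^y = e^{y log x}·cos(yπ)`, so `r(g)·p(g) = b₀·x^{r₀}·x^{2r₀+1}` has the sign of `cos(r₀π)·cos((2r₀+1)π)`: ★ `farCurrency_neg_of_r₀_eq_two` (`r₀ = 2`: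
  `cos 2π · cos 5π = −1`, currency `< 0`), `farCurrency_nonneg_of_r₀_eq_one` (`r₀ = 1`: `x·x³ = x⁴ ≥ 0`, no obstruction); `exists_gk_gt` (every lattice
  approximation has steps with `g_k` above any bound, since `L > 1`); ★★ `isEmpty_alphaData_of_r₀_eq_two`: for a record with `r₀ = 2` and `Cfar·C63 > 0`
  the (α) auxiliary data do not exist at ANY lattice approximation — every ∀𝔄-statement of the (α) lineage is vacuous there and every ∃(𝔠 with r₀ = 2, 𝔄)
  pin unsatisfiable; conversely `alphaDataZero_of_r₀_eq_one` ∕ `nonempty_alphaData_zeroRun_of_r₀_eq_one`: for `r₀ = 1` the bundle IS inhabited (by the zero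
  auxiliary data of `…N08AlphaZeroData`) at every lattice approximation.
READING (LOCATED, for the lane's custodian ∕ dag-lead; NOT a defect of any landed theorem): print fixes no numerical `r₀` («R(g) = R₁(1 + log g⁻¹)^{r₀}»,
p. 257); the run reads G3D-07∕08 only at `k < K`, where `g_k ≤ 1` and the currency is nonnegative (`…ZeroData.farCurrency_nonneg_of_le_one`); the
emptiness comes ONLY from `AlphaData`'s quantifier range `∀ k : ℕ`.  Repairs (not made here; the lane is closed, custodian-on-wake): restrict `Λc ∕ N45` to
`k < S.K`, or state G3D-06 with `|c|`, or keep `r₀` with `cos(r₀π)·cos((2r₀+1)π) ≥ 0` (e.g. `r₀ = 1`) in every `∃ 𝔠` pin — gens 3–5's closers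
(`∃ 𝔠 …`) are unaffected in substance since they may choose such a record.  HONEST FRAMING: count-neutral statements about the TYPING of the lane's (α)
clause; nothing of [B10] asserted; N08 NOT discharged; d = 3 lattice gauge theory on finite tori; nothing about d = 4, the continuum, OS axioms, a mass
gap or Clay.
-/

noncomputable section

namespace Summit.QuantumFields.YangMills.Theorems.BalabanUVNodesN08AlphaFarCurrency

open MeasureTheory Metric
open scoped BigOperators
open Literature.MathematicalPhysics.QuantumFieldTheory.Balaban1983to89
open Literature.MathematicalPhysics.QuantumFieldTheory.Balaban1983to89.B10
open Literature.MathematicalPhysics.QuantumFieldTheory.Balaban1983to89.TreeLengthTorus (tsys TDom TPt torusTreeLen_singleton)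
open Literature.MathematicalPhysics.QuantumFieldTheory.Balaban1985CMP102
open Literature.MathematicalPhysics.QuantumFieldTheory.Balaban1985CMP102.Setting
open Summit.QuantumFields.Balaban3D.Carriers
open Summit.QuantumFields.Balaban3D.Proofs.Inputs
open Summit.QuantumFields.Balaban3D.Proofs.Primitives (AlphaConsts)
open Summit.QuantumFields.Balaban3D.Proofs.GroupModelLieC (lieC)
open Summit.QuantumFields.Balaban3D.Proofs.UVStability3DInputs
open Summit.QuantumFields.Balaban3D.Proofs.ScalesArithmetic (gk_pos)

variable {L : ℕ}

/-! ## §1 Negative far currency empties `AlphaData` -/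

section Empty

variable {S : Scales L} {G : Type} [GaugeGroup G] [MeasurableSpace G] [HaarData G] (𝔊 : GroupModel G) (𝔠 : AlphaConsts L 𝔊.N)
  (X : ExternalInputs S G) (𝔖 : ∀ k, StepSeries S G ↥(lieC 𝔊) (nblkOf S 𝔠.lane.carrier k) k)

/-- The ONE-BLOCK localisation domain `{0}` of the torus block carrier (nonempty and trivially face-connected): the quantifier domain of G3D-06 is
inhabited. [folklore] -/
def singletonDom (N : ℕ) [NeZero N] : TDom 3 N :=
  ⟨{0}, Finset.singleton_nonempty _, fun x hx y hy => by
    rw [Finset.mem_singleton] at hx hy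
    subst hx; subst hy
    exact Relation.ReflTransGen.refl⟩

/-- ★ **NEGATIVE FAR CURRENCY AT ANY STEP EMPTIES THE (α) AUXILIARY DATA.**  If the record's far and (63) amplitudes are positive and at some step `k` the
seventh-order currency `g_k⁷·(r(g_k)·p(g_k))⁷` is negative, then NO `AlphaData 𝔊 𝔠 X 𝔖` exists, whatever the external inputs and the series: its field
`(Λc k).far_le` (G3D-06 `FarTermsDecayAsCited`) at the one-block domain, the trivial history and the unit field would give `|far| ≤ Cfar·(C63·e^{−κ𝓛}·c) < 0`.
[cite: Balaban1985UV3, p.264 L14–20 + p.271 L6–8 (G3D-06 as typed, read at every k)] -/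
theorem isEmpty_alphaData_of_farCurrency_neg (hCfar : 0 < 𝔠.Cfar) (hC63 : 0 < 𝔠.C63) {k : ℕ}
    (hneg : S.gk k ^ 7 * (rFun 𝔠.r₀ (S.gk k) * pFun 𝔠.b₀ 𝔠.p₀ (S.gk k)) ^ 7 < 0) :
    IsEmpty (AlphaData 𝔊 𝔠 X 𝔖) := by
  refine ⟨fun 𝔄 => ?_⟩
  have h := (𝔄.Λc k).far_le (singletonDom (nblkOf S 𝔠.lane.carrier k)) (Hist.triv S.P (k + 1)) (fun _ => 1)
  have hexp : 0 < Real.exp (-(𝔠.κ * (tsys 3 (nblkOf S 𝔠.lane.carrier k)).dj (singletonDom (nblkOf S 𝔠.lane.carrier k)))) :=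
    Real.exp_pos _
  have hlt : 𝔠.Cfar * (𝔠.C63 * Real.exp (-(𝔠.κ * (tsys 3 (nblkOf S 𝔠.lane.carrier k)).dj (singletonDom (nblkOf S 𝔠.lane.carrier k)))) *
      ((towerOf 𝔠.lane X 𝔖).g k ^ 7 * (rFun 𝔠.r₀ ((towerOf 𝔠.lane X 𝔖).g k) *
        pFun (towerOf 𝔠.lane X 𝔖).b₀ (towerOf 𝔠.lane X 𝔖).p₀ ((towerOf 𝔠.lane X 𝔖).g k)) ^ 7)) < 0 := by
    show 𝔠.Cfar * (𝔠.C63 * Real.exp (-(𝔠.κ * (tsys 3 (nblkOf S 𝔠.lane.carrier k)).dj (singletonDom (nblkOf S 𝔠.lane.carrier k)))) *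
      (S.gk k ^ 7 * (rFun 𝔠.r₀ (S.gk k) * pFun 𝔠.b₀ 𝔠.p₀ (S.gk k)) ^ 7)) < 0
    exact mul_neg_of_pos_of_neg hCfar (mul_neg_of_pos_of_neg (mul_pos hC63 hexp) hneg)
  exact absurd (lt_of_le_of_lt (abs_nonneg _) (lt_of_le_of_lt h hlt)) (lt_irrefl _)

end Empty

/-! ## §2 The sign of the currency off the run: `r₀ = 2` is obstructed, `r₀ = 1` is not -/

section Sign

variable {S : Scales L} {N : ℕ} (𝔠 : AlphaConsts L N)

/-- Off the run the chart variable of `r`∕`p` is negative: `g > e ⇒ 1 + log g⁻¹ < 0`. [folklore] -/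
theorem one_add_log_inv_neg {g : ℝ} (hg : Real.exp 1 < g) : 1 + Real.log g⁻¹ < 0 := by
  have hg0 : 0 < g := lt_trans (Real.exp_pos 1) hg
  rw [Real.log_inv]
  have : 1 < Real.log g := by
    rw [← Real.log_exp 1]
    exact Real.log_lt_log (Real.exp_pos 1) hg
  linarith

/-- ★ **`r₀ = 2` (so `p₀ = 2r₀ + 1 = 5`): the far currency is NEGATIVE at every step with `g_k > e`** — `x^2·x^5 = e^{7 log x}·cos 2π·cos 5π < 0` for the
negative base `x = 1 + log g_k⁻¹` (Mathlib's `Real.rpow_def_of_neg`). [cite: Balaban1985UV3, (7) p.257 (r₀ not fixed numerically in print)] -/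
theorem farCurrency_neg_of_r₀_eq_two (hr : 𝔠.r₀ = 2) {k : ℕ} (hg : Real.exp 1 < S.gk k) :
    S.gk k ^ 7 * (rFun 𝔠.r₀ (S.gk k) * pFun 𝔠.b₀ 𝔠.p₀ (S.gk k)) ^ 7 < 0 := by
  have hx := one_add_log_inv_neg hg
  set x : ℝ := 1 + Real.log (S.gk k)⁻¹ with hxdef
  have hp : 𝔠.p₀ = 5 := by rw [AlphaConsts.p₀, hr]; norm_num
  have hr2 : rFun 𝔠.r₀ (S.gk k) = Real.exp (Real.log x * 2) := by
    rw [rFun, hr, ← hxdef, Real.rpow_def_of_neg hx]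
    rw [show (2 : ℝ) * Real.pi = (1 : ℕ) * (2 * Real.pi) by push_cast; ring, Real.cos_nat_mul_two_pi, mul_one]
  have hp5 : pFun 𝔠.b₀ 𝔠.p₀ (S.gk k) = -(𝔠.b₀ * Real.exp (Real.log x * 5)) := by
    rw [pFun, hp, ← hxdef, Real.rpow_def_of_neg hx]
    rw [show (5 : ℝ) * Real.pi = Real.pi + (2 : ℕ) * (2 * Real.pi) by push_cast; ring, Real.cos_add_nat_mul_two_pi, Real.cos_pi]
    ring
  have hrp : rFun 𝔠.r₀ (S.gk k) * pFun 𝔠.b₀ 𝔠.p₀ (S.gk k) < 0 := by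
    rw [hr2, hp5, mul_neg_iff]
    left
    exact ⟨Real.exp_pos _, neg_lt_zero.mpr (mul_pos 𝔠.b₀_pos (Real.exp_pos _))⟩
  have h7 : (rFun 𝔠.r₀ (S.gk k) * pFun 𝔠.b₀ 𝔠.p₀ (S.gk k)) ^ 7 < 0 :=
    Odd.pow_neg (by decide) hrp
  exact mul_neg_of_pos_of_neg (pow_pos (gk_pos S k) 7) h7

/-- `r₀ = 1` (so `p₀ = 3`): the far currency is NONNEGATIVE at every step, also off the run (`x¹·x³ = x⁴ ≥ 0`): no obstruction for print's
simplest integer exponent. [cite: Balaban1985UV3, (7) p.257] -/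
theorem farCurrency_nonneg_of_r₀_eq_one (hr : 𝔠.r₀ = 1) (k : ℕ) :
    0 ≤ S.gk k ^ 7 * (rFun 𝔠.r₀ (S.gk k) * pFun 𝔠.b₀ 𝔠.p₀ (S.gk k)) ^ 7 := by
  have hp : 𝔠.p₀ = 3 := by rw [AlphaConsts.p₀, hr]; norm_num
  have hrp : 0 ≤ rFun 𝔠.r₀ (S.gk k) * pFun 𝔠.b₀ 𝔠.p₀ (S.gk k) := by
    rw [rFun, pFun, hr, hp, Real.rpow_one, show (3 : ℝ) = ((3 : ℕ) : ℝ) by norm_num, Real.rpow_natCast]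
    have hb := 𝔠.b₀_pos.le
    set x : ℝ := 1 + Real.log (S.gk k)⁻¹
    have : x * (𝔠.b₀ * x ^ 3) = 𝔠.b₀ * (x ^ 2) ^ 2 := by ring
    rw [this]
    positivity
  exact mul_nonneg (pow_nonneg (gk_pos S k).le 7) (pow_nonneg hrp 7)

/-- Every lattice approximation has steps with arbitrarily LARGE running coupling: `g_k = g·√(L^kε)` and `L > 1`.  (The run only reads `k ≤ K`, where
`g_k ≤ 1` on the family; `AlphaData` reads every `k`.) [cite: Balaban1985UV3, p.256 (g_k = g(L^kε)^{1/2})] -/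
theorem exists_gk_gt (S : Scales L) (c : ℝ) : ∃ k : ℕ, c < S.gk k := by
  have hL : (1 : ℝ) < (L : ℝ) := by exact_mod_cast S.hL.2
  have hg : 0 < S.g := S.g_pos
  have hε : 0 < S.ε := S.ε_pos
  -- `L^k ε → ∞`, hence `g √(L^k ε) → ∞`
  obtain ⟨k, hk⟩ := pow_unbounded_of_one_lt ((c / S.g) ^ 2 / S.ε) hL
  refine ⟨k, ?_⟩
  show c < S.g * Real.sqrt ((L : ℝ) ^ k * S.ε)
  have h1 : (c / S.g) ^ 2 < (L : ℝ) ^ k * S.ε := by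
    rw [div_lt_iff₀ hε] at hk
    linarith
  by_cases hc : c < 0
  · exact lt_of_lt_of_le hc (mul_nonneg hg.le (Real.sqrt_nonneg _))
  · have hc' : 0 ≤ c := not_lt.mp hc
    have hcg : 0 ≤ c / S.g := div_nonneg hc' hg.le
    have h2 : c / S.g < Real.sqrt ((L : ℝ) ^ k * S.ε) := by
      rw [← Real.sqrt_sq hcg]
      exact Real.sqrt_lt_sqrt (sq_nonneg _) h1
    rwa [div_lt_iff₀' hg] at h2

end Sign

/-! ## §3 The located emptiness for `r₀ = 2` records -/

section Located

variable {S : Scales L} {G : Type} [GaugeGroup G] [MeasurableSpace G] [HaarData G] (𝔊 : GroupModel G) (𝔠 : AlphaConsts L 𝔊.N)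
  (X : ExternalInputs S G) (𝔖 : ∀ k, StepSeries S G ↥(lieC 𝔊) (nblkOf S 𝔠.lane.carrier k) k)

/-- ★★ **FOR A CONSTANTS RECORD WITH `r₀ = 2` AND POSITIVE FAR ∕ (63) AMPLITUDES THE (α) AUXILIARY DATA DO NOT EXIST AT ANY LATTICE APPROXIMATION**:
`IsEmpty (AlphaData 𝔊 𝔠 X 𝔖)` for every `S`, `X`, `𝔖` — by `exists_gk_gt` some step has `g_k > e`, there the far currency is negative
(`farCurrency_neg_of_r₀_eq_two`), and G3D-06 at that step is unsatisfiable (`isEmpty_alphaData_of_farCurrency_neg`).  LOCATED typing looseness (the run never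
reads that step); the (α) lineage's `∃ 𝔠` closers stay satisfiable by records with e.g. `r₀ = 1` (`farCurrency_nonneg_of_r₀_eq_one`).
[cite: Balaban1985UV3, (7) p.257 + p.264 L14–20] -/
theorem isEmpty_alphaData_of_r₀_eq_two (hCfar : 0 < 𝔠.Cfar) (hC63 : 0 < 𝔠.C63) (hr : 𝔠.r₀ = 2) :
    IsEmpty (AlphaData 𝔊 𝔠 X 𝔖) := by
  obtain ⟨k, hk⟩ := exists_gk_gt S (Real.exp 1)
  exact isEmpty_alphaData_of_farCurrency_neg 𝔊 𝔠 X 𝔖 hCfar hC63 (farCurrency_neg_of_r₀_eq_two 𝔠 hr hk)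

/-- Consequently, for such a record the (α) clause `RunAlpha 𝔊 𝔠 X 𝔖 𝔄` has NO instance to speak about: every statement `∀ 𝔄, RunAlpha … 𝔄 → …`
of the lineage holds vacuously and no pin `∃ 𝔄, RunAlpha … 𝔄 ∧ …` can be met. [cite: Balaban1985UV3, (41) p.266 (bookkeeping over the typed clause)] -/
theorem not_exists_runAlpha_of_r₀_eq_two (hCfar : 0 < 𝔠.Cfar) (hC63 : 0 < 𝔠.C63) (hr : 𝔠.r₀ = 2) :
    ¬ ∃ 𝔄 : AlphaData 𝔊 𝔠 X 𝔖, RunAlpha 𝔊 𝔠 X 𝔖 𝔄 := by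
  rintro ⟨𝔄, -⟩
  exact (isEmpty_alphaData_of_r₀_eq_two 𝔊 𝔠 X 𝔖 hCfar hC63 hr).false 𝔄

/-- **… WHEREAS FOR `r₀ = 1` THE BUNDLE IS INHABITED AT ZERO DATA at every lattice approximation**: the zero auxiliary data of
`…N08AlphaZeroData` with its far-currency hypothesis discharged by `farCurrency_nonneg_of_r₀_eq_one` — the dichotomy for print's two smallest
integer exponents. [cite: Balaban1985UV3, (7) p.257 + (63) p.272] -/
def alphaDataZero_of_r₀_eq_one (hr : 𝔠.r₀ = 1) : AlphaData 𝔊 𝔠 X (BalabanUVNodesN08AlphaZeroData.zeroRun 𝔊 𝔠) :=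
  BalabanUVNodesN08AlphaZeroData.zeroAlpha 𝔊 𝔠 X fun k =>
    mul_nonneg 𝔠.Cfar_nonneg (mul_nonneg 𝔠.C63_nonneg (farCurrency_nonneg_of_r₀_eq_one 𝔠 hr k))

/-- `AlphaData` at the zero series is NONEMPTY for `r₀ = 1` records (any amplitudes), EMPTY for `r₀ = 2` records with positive amplitudes.
[cite: Balaban1985UV3, (7) p.257 (bookkeeping over the typed bundle)] -/
theorem nonempty_alphaData_zeroRun_of_r₀_eq_one (hr : 𝔠.r₀ = 1) :
    Nonempty (AlphaData 𝔊 𝔠 X (BalabanUVNodesN08AlphaZeroData.zeroRun 𝔊 𝔠)) :=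
  ⟨alphaDataZero_of_r₀_eq_one 𝔊 𝔠 X hr⟩

end Located

end Summit.QuantumFields.YangMills.Theorems.BalabanUVNodesN08AlphaFarCurrency

end
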